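import Summits.CriticalPhenomena.PercolationContinuityZ3.Theorems.PercNearOneGluingNoHeavyQuantBlockCombMergeModel
import HarnessLib

/-!
# QUANT lane R8, FAR on trees: every BLOCK-COMB in the strong regime `(Σ sizes)·g_k > 2j` — the merge induction

builds on p205010 (kernel theorem, internal audit signed; external expert review pending)

Support file (`--supports stmt-CriticalPhenomena-4575`), QUANT lane seat prim-quant-p1 (gen 8); memo
`run/shared/lean/prim/quant/P1-SURPLUS.md` §19.3.  Theorems only (local notation, no definitions), no sorries, standard axioms.
Model and merge step: `…QuantBlockCombMergeModel.lean` (same notation: chain gates `q`, levels `lv`, sizes `a`, private gates `g`, explicit tail `TAIL`).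

* `Quant.BlockComb.tail_factor` — no live blob at level `0` ⟹ `TAIL[D+1, q] = q 0 · TAIL[D, q ∘ succ]` (levels shifted down).
* `Quant.BlockComb.tail_ge_marg_strong` — **THEOREM (FAR at every layer for block-combs in the strong regime).**  If `2j < (Σ_k a k)·g k` for
  every live blob `k` then `TAIL ≥ (∏_{i<lv k} q i)·g k` for SOME live blob `k`; hence (`tail_ge_of_le_marg_strong`) `TAIL ≥ x` for every `x`
  below all live marginals — the far-relay row `P(N ≥ j+1) ≥ min marginal` for this family.  PROOF: induction on `#live blobs + D`: a blob with
  `≥ j+1` relays ⟹ `tail_ge_marg_of_giant`; else a live ROOT-LEVEL blob `s` ⟹ `tail_transfer_le` (its hypothesis `j ≤ g_s (n − a_s)` from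
  `2j < n g_s`, `a_s ≤ j`, `g_s ≤ 1`), one live blob fewer, total size and all gates unchanged; else `tail_factor` and the chain is shorter.
  One blob moves at a time and the chain weights stay exact — no window functional ((TW-strong), the intended route of LEAD-NOTES-G10 N21 (4) for
  exactly this regime, is false: postcont-1 g38).  CONTAINS: every ALL-TIED block-comb (all marginals `= x`, `EN = n·x > 2j`; the interior extremal
  structure of N21 (7b) within block-combs), '(FO′)-mono' = the blob-sojourn inequality `E#opportunities + P(S_K ∈ (j−c, j]) ≥ 1` for nondecreasing
  gates under `(A+c)·g_1 > 2j` (N21 (5b)), every block-comb with `|A|·x > 2j`, multi-level hubs, tied 'hub + leaves + root blocks' for every `x`.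
Honest scope: the WEAK-hypothesis row (`EN > 2j`) for non-tied block-combs (N21 (6) staircases) is not claimed; forests with two relay-free roots
and no root-level blob are outside the induction (conjecture (GM), P1-SURPLUS §19.4).  The route-vocabulary wrapper (tree-supported bond weights on
`Sym2 (Fin n)` via `Quant.tree_relayCount_transfer`, as `…QuantFarRelayRowBlockCombCell`) is the typer's follow-up.
-/

namespace Summit.CriticalPhenomena.PercolationContinuityZ3.Theorems

namespace Quant

namespace BlockComb

open Finset

variable {κ : Type*} [Fintype κ] [DecidableEq κ]

/-- product-Bernoulli weight of the set `S` of open blob gates -/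
local notation3 "wt[" g ", " S "]" => ∏ k, (if k ∈ (S : Finset κ) then (g : κ → ℝ) k else 1 - (g : κ → ℝ) k)

/-- the same weight with the gate of `s` removed -/
local notation3 "wt'[" g ", " s ", " S "]" =>
  ∏ k ∈ (Finset.univ : Finset κ).erase s, (if k ∈ (S : Finset κ) then (g : κ → ℝ) k else 1 - (g : κ → ℝ) k)

/-- probability that the chain `q` of length `D` is open exactly to depth `i` -/
local notation3 "pd[" D ", " q ", " i "]" =>
  (∏ i' ∈ Finset.range (i : ℕ), (q : ℕ → ℝ) i') * (if (i : ℕ) < (D : ℕ) then 1 - (q : ℕ → ℝ) i else 1)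

/-- mass counted at depth `i` in blob configuration `S` -/
local notation3 "mass[" lv ", " a ", " i ", " S "]" =>
  ∑ k ∈ (S : Finset κ).filter (fun k => (lv : κ → ℕ) k ≤ (i : ℕ)), ((a : κ → ℕ) k : ℕ)

/-- the tail `P(N ≥ j+1)` of the block-comb count, as an explicit finite sum -/
local notation3 "TAIL[" D ", " q ", " lv ", " a ", " g ", " j "]" =>
  ∑ i ∈ Finset.range ((D : ℕ) + 1), pd[D, q, i] *
    ∑ S : Finset κ, wt[g, S] * (if (j : ℕ) + 1 ≤ mass[lv, a, i, S] then (1 : ℝ) else 0)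

/-! ### 5. Factoring the top gate -/

/-- **No live blob at the root level ⟹ factor the top gate**: `TAIL[D+1, q] = q 0 · TAIL[D, q ∘ succ]` with levels shifted down. [this work] -/
theorem tail_factor (D : ℕ) (q : ℕ → ℝ) (lv : κ → ℕ) (a : κ → ℕ) (g : κ → ℝ) (j : ℕ)
    (h : ∀ k, 0 < a k → 1 ≤ lv k) :
    TAIL[D + 1, q, lv, a, g, j] = q 0 * TAIL[D, (fun i => q (i + 1)), (fun k => lv k - 1), a, g, j] := by
  rw [Finset.sum_range_succ']
  -- depth `0`: nothing is counted
  have h0 : ∀ S : Finset κ, ¬ (j + 1 ≤ mass[lv, a, 0, S]) := by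
    intro S hle
    have hzero : mass[lv, a, 0, S] = 0 := by
      refine Finset.sum_eq_zero fun k hk => ?_
      have hk0 : lv k ≤ 0 := (Finset.mem_filter.1 hk).2
      by_contra hne
      have := h k (Nat.pos_of_ne_zero hne)
      omega
    rw [hzero] at hle
    omega
  have hterm0 : pd[D + 1, q, 0] * ∑ S : Finset κ, wt[g, S] * (if j + 1 ≤ mass[lv, a, 0, S] then (1 : ℝ) else 0) = 0 := by
    rw [Finset.sum_eq_zero fun S _ => by rw [if_neg (h0 S), mul_zero], mul_zero]
  rw [hterm0, add_zero, Finset.mul_sum]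
  refine Finset.sum_congr rfl fun i hi => ?_
  have hiD : i < D + 1 := Finset.mem_range.1 hi
  -- the depth law
  have hpd : pd[D + 1, q, i + 1] = q 0 * pd[D, (fun i => q (i + 1)), i] := by
    show (∏ i' ∈ Finset.range (i + 1), q i') * (if i + 1 < D + 1 then 1 - q (i + 1) else 1) =
      q 0 * ((∏ i' ∈ Finset.range i, q (i' + 1)) * (if i < D then 1 - q (i + 1) else 1))
    rw [Finset.prod_range_succ']
    by_cases hi' : i < D
    · rw [if_pos hi', if_pos (by omega)]; ring
    · rw [if_neg hi', if_neg (by omega)]; ring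
  -- the mass at depth `i+1` is the shifted mass at depth `i`
  have hmass : ∀ S : Finset κ, mass[lv, a, i + 1, S] = mass[(fun k => lv k - 1), a, i, S] := by
    intro S
    refine Finset.sum_congr ?_ fun _ _ => rfl
    ext k
    simp only [Finset.mem_filter]
    constructor
    · rintro ⟨hk, hle⟩; exact ⟨hk, by omega⟩
    · rintro ⟨hk, hle⟩; exact ⟨hk, by omega⟩
  rw [hpd, mul_assoc]
  congr 1
  congr 1
  exact Finset.sum_congr rfl fun S _ => by rw [hmass S]

/-! ### 6. The theorem: merge induction -/

/-- The induction behind `tail_ge_marg_strong` (on `#live blobs + D`): giant / merge a root-level blob / factor the top gate. [this work] -/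
theorem tail_ge_marg_strong_aux : ∀ (N : ℕ) (D : ℕ) (q : ℕ → ℝ), (∀ i, 0 ≤ q i ∧ q i ≤ 1) →
    ∀ (lv : κ → ℕ) (a : κ → ℕ) (g : κ → ℝ), (∀ k, 0 ≤ g k ∧ g k ≤ 1) → ∀ (j : ℕ),
    (∀ k, 0 < a k → lv k ≤ D) →
    (∀ k, 0 < a k → (2 * j : ℝ) < (∑ k', (a k' : ℝ)) * g k) →
    (∃ k, 0 < a k) →
    (Finset.univ.filter (fun k => 0 < a k)).card + D ≤ N →
    ∃ k, 0 < a k ∧ (∏ i ∈ Finset.range (lv k), q i) * g k ≤ TAIL[D, q, lv, a, g, j] := by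
  intro N
  induction N with
  | zero =>
    intro D q hq lv a g hg j hlv hstrong hne hN
    obtain ⟨k, hk⟩ := hne
    have hcard : 0 < (Finset.univ.filter (fun k => 0 < a k)).card :=
      Finset.card_pos.2 ⟨k, Finset.mem_filter.2 ⟨Finset.mem_univ _, hk⟩⟩
    omega
  | succ N ih =>
    intro D q hq lv a g hg j hlv hstrong hne hN
    -- (i) a giant blob
    by_cases hgiant : ∃ k, 0 < a k ∧ j + 1 ≤ a k
    · obtain ⟨k, hk, hkj⟩ := hgiant
      exact ⟨k, hk, tail_ge_marg_of_giant D q hq lv a g hg j k hkj (hlv k hk)⟩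
    push Not at hgiant
    -- total size
    set n : ℝ := ∑ k', (a k' : ℝ) with hn
    by_cases hroot : ∃ s, 0 < a s ∧ lv s = 0
    · -- (ii) merge a root-level blob into some other blob
      obtain ⟨s, hs, hs0⟩ := hroot
      have hsj : a s ≤ j := Nat.lt_succ_iff.1 (hgiant s hs)
      set a₀ := Function.update a s 0 with ha₀
      have ha₀s : a₀ s = 0 := by rw [ha₀, Function.update_self]
      have ha₀ne : ∀ k, k ≠ s → a₀ k = a k := fun k hk => by rw [ha₀, Function.update_of_ne hk]
      -- Σ a₀ = n − a s
      have hsum₀ : ∑ k, ((a₀ k : ℕ) : ℝ) = n - a s := by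
        rw [hn, Finset.sum_eq_add_sum_sdiff_singleton_of_mem (Finset.mem_univ s) (fun k => (a k : ℝ)),
          Finset.sum_eq_add_sum_sdiff_singleton_of_mem (Finset.mem_univ s) (fun k => ((a₀ k : ℕ) : ℝ)), ha₀s]
        push_cast
        have : ∑ x ∈ Finset.univ \ {s}, ((a₀ x : ℕ) : ℝ) = ∑ x ∈ Finset.univ \ {s}, (a x : ℝ) :=
          Finset.sum_congr rfl fun k hk => by
            have hks : k ≠ s := fun h => by
              rw [Finset.mem_sdiff, Finset.mem_singleton] at hk; exact hk.2 h
            rw [ha₀ne k hks]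
        rw [this]; ring
      -- another live blob exists (else `s` alone carries `n > 2j` relays, a giant)
      have hpos : ∃ k, 0 < a₀ k := by
        by_contra hnone
        push Not at hnone
        have hzero : ∀ k, k ≠ s → a k = 0 := fun k hk => by
          have := hnone k; rw [ha₀ne k hk] at this; omega
        have hns : n = a s := by
          rw [hn, Finset.sum_eq_add_sum_sdiff_singleton_of_mem (Finset.mem_univ s) (fun k => (a k : ℝ))]
          rw [Finset.sum_eq_zero fun k hk => by
            have hks : k ≠ s := fun h => by
              rw [Finset.mem_sdiff, Finset.mem_singleton] at hk; exact hk.2 h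
            rw [hzero k hks]; simp]
          ring
        have h1 := hstrong s hs
        rw [hns] at h1
        have h2 : (a s : ℝ) * g s ≤ a s := by nlinarith [(hg s).1, (hg s).2, (Nat.cast_nonneg (a s) : (0:ℝ) ≤ a s)]
        have h3 : (a s : ℝ) ≤ j := by exact_mod_cast hsj
        have h4 : (0 : ℝ) ≤ j := Nat.cast_nonneg j
        linarith
      -- the merge hypothesis `j ≤ g s · (n − a s)`
      have hM : (j : ℝ) ≤ g s * ∑ k, ((a₀ k : ℕ) : ℝ) := by
        rw [hsum₀]
        have h1 := hstrong s hs
        have h2 : (a s : ℝ) * g s ≤ a s := by nlinarith [(hg s).1, (hg s).2, (Nat.cast_nonneg (a s) : (0:ℝ) ≤ a s)]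
        have h3 : (a s : ℝ) ≤ j := by exact_mod_cast hsj
        nlinarith [(hg s).1, (hg s).2]
      obtain ⟨ℓ, hℓ, hle⟩ := tail_transfer_le D q hq lv a g hg j s hs0 hM hpos
      have hℓs : ℓ ≠ s := by
        rintro rfl; simp [Function.update_self] at hℓ
      have haℓ : 0 < a ℓ := by rw [← ha₀ne ℓ hℓs]; exact hℓ
      set aT := Function.update a₀ ℓ (a₀ ℓ + a s) with haT
      have haTs : aT s = 0 := by rw [haT, Function.update_of_ne hℓs.symm, ha₀s]
      have haTℓ : aT ℓ = a ℓ + a s := by rw [haT, Function.update_self, ha₀ne ℓ hℓs]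
      have haTne : ∀ k, k ≠ s → k ≠ ℓ → aT k = a k := fun k hks hkℓ => by
        rw [haT, Function.update_of_ne hkℓ, ha₀ne k hks]
      -- live blobs of `aT` are live blobs of `a`, and `s` is not among them
      have hlive : ∀ k, 0 < aT k → 0 < a k ∧ k ≠ s := by
        intro k hk
        have hks : k ≠ s := fun h => by rw [h, haTs] at hk; exact lt_irrefl _ hk
        refine ⟨?_, hks⟩
        by_cases hkℓ : k = ℓ
        · rw [hkℓ]; exact haℓ
        · rw [← haTne k hks hkℓ]; exact hk
      have hcard : (Finset.univ.filter (fun k => 0 < aT k)).card + 1 ≤ (Finset.univ.filter (fun k => 0 < a k)).card := by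
        have hsub : Finset.univ.filter (fun k => 0 < aT k) ⊆ (Finset.univ.filter (fun k => 0 < a k)).erase s := by
          intro k hk
          have hk' := (Finset.mem_filter.1 hk).2
          exact Finset.mem_erase.2 ⟨(hlive k hk').2, Finset.mem_filter.2 ⟨Finset.mem_univ _, (hlive k hk').1⟩⟩
        have hsmem : s ∈ Finset.univ.filter (fun k => 0 < a k) := Finset.mem_filter.2 ⟨Finset.mem_univ _, hs⟩
        have := Finset.card_le_card hsub
        rw [Finset.card_erase_of_mem hsmem] at this
        have hpos' : 0 < (Finset.univ.filter (fun k => 0 < a k)).card := Finset.card_pos.2 ⟨s, hsmem⟩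
        omega
      -- total size is unchanged
      have hsumT : ∑ k', ((aT k' : ℕ) : ℝ) = n := by
        rw [Finset.sum_eq_add_sum_sdiff_singleton_of_mem (Finset.mem_univ ℓ) (fun k => ((aT k : ℕ) : ℝ)), haTℓ]
        have : ∑ x ∈ Finset.univ \ {ℓ}, ((aT x : ℕ) : ℝ) = ∑ x ∈ Finset.univ \ {ℓ}, ((a₀ x : ℕ) : ℝ) :=
          Finset.sum_congr rfl fun k hk => by
            have hkℓ : k ≠ ℓ := fun h => by
              rw [Finset.mem_sdiff, Finset.mem_singleton] at hk; exact hk.2 h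
            rw [haT, Function.update_of_ne hkℓ]
        rw [this]
        have h₀ := Finset.sum_eq_add_sum_sdiff_singleton_of_mem (Finset.mem_univ ℓ) (fun k => ((a₀ k : ℕ) : ℝ))
        rw [hsum₀, ha₀ne ℓ hℓs] at h₀
        push_cast
        linarith
      -- induction hypothesis for the transferred configuration
      have hlvT : ∀ k, 0 < aT k → lv k ≤ D := fun k hk => hlv k (hlive k hk).1
      have hstrongT : ∀ k, 0 < aT k → (2 * j : ℝ) < (∑ k', (aT k' : ℝ)) * g k := by
        intro k hk
        rw [hsumT]
        exact hstrong k (hlive k hk).1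
      have hneT : ∃ k, 0 < aT k := ⟨ℓ, by rw [haTℓ]; omega⟩
      have hNT : (Finset.univ.filter (fun k => 0 < aT k)).card + D ≤ N := by omega
      obtain ⟨k, hk, hmarg⟩ := ih D q hq lv aT g hg j hlvT hstrongT hneT hNT
      exact ⟨k, (hlive k hk).1, hmarg.trans hle⟩
    · -- (iii) no live blob at the root level: factor the top gate
      push Not at hroot
      have hlv1 : ∀ k, 0 < a k → 1 ≤ lv k := fun k hk => Nat.one_le_iff_ne_zero.2 (hroot k hk)
      obtain ⟨k₀, hk₀⟩ := hne
      have hD : 1 ≤ D := le_trans (hlv1 k₀ hk₀) (hlv k₀ hk₀)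
      obtain ⟨D', rfl⟩ : ∃ D', D = D' + 1 := ⟨D - 1, by omega⟩
      rw [tail_factor D' q lv a g j hlv1]
      have hq' : ∀ i, 0 ≤ (fun i => q (i + 1)) i ∧ (fun i => q (i + 1)) i ≤ 1 := fun i => hq (i + 1)
      have hlv' : ∀ k, 0 < a k → (fun k => lv k - 1) k ≤ D' := fun k hk => by
        have := hlv k hk; simp only; omega
      have hN' : (Finset.univ.filter (fun k => 0 < a k)).card + D' ≤ N := by omega
      obtain ⟨k, hk, hmarg⟩ := ih D' (fun i => q (i + 1)) hq' (fun k => lv k - 1) a g hg j hlv' hstrong ⟨k₀, hk₀⟩ hN'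
      refine ⟨k, hk, ?_⟩
      have hlvk : lv k = (lv k - 1) + 1 := by have := hlv1 k hk; omega
      have hprod : (∏ i ∈ Finset.range (lv k), q i) = q 0 * ∏ i ∈ Finset.range (lv k - 1), q (i + 1) := by
        rw [hlvk, Finset.prod_range_succ']
        simp only [Nat.add_sub_cancel]
        ring
      rw [hprod, mul_assoc]
      exact mul_le_mul_of_nonneg_left hmarg (hq 0).1

/-- **THEOREM (FAR at every layer for block-combs in the strong regime, canonical model).**  For a chain `q` of `D` gates and blobs
`k` with levels `lv k ≤ D`, sizes `a k` and private gates `g k`: if `2j < (Σ_k a k)·g k` for every live blob `k` (`a k > 0`), then the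
tail `P(N ≥ j+1)` of the block-comb count is at least the marginal `(∏_{i<lv k} q i)·g k` of SOME live blob `k`. [this work] -/
theorem tail_ge_marg_strong (D : ℕ) (q : ℕ → ℝ) (hq : ∀ i, 0 ≤ q i ∧ q i ≤ 1) (lv : κ → ℕ) (a : κ → ℕ)
    (g : κ → ℝ) (hg : ∀ k, 0 ≤ g k ∧ g k ≤ 1) (j : ℕ) (hlv : ∀ k, 0 < a k → lv k ≤ D)
    (hstrong : ∀ k, 0 < a k → (2 * j : ℝ) < (∑ k', (a k' : ℝ)) * g k) (hne : ∃ k, 0 < a k) :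
    ∃ k, 0 < a k ∧ (∏ i ∈ Finset.range (lv k), q i) * g k ≤ TAIL[D, q, lv, a, g, j] :=
  tail_ge_marg_strong_aux _ D q hq lv a g hg j hlv hstrong hne le_rfl

/-- **COROLLARY (the far-relay row for block-combs in the strong regime).**  Under the same hypotheses, every `x` below all live blob
marginals (in particular the least marginal, `= 1 − t` in `Quant.FarRelayRow`'s normal form) satisfies `x ≤ P(N ≥ j+1)`; this contains every
ALL-TIED block-comb (`x` = the common marginal, `EN = (Σ a)·x > 2j`). [this work] -/
theorem tail_ge_of_le_marg_strong (D : ℕ) (q : ℕ → ℝ) (hq : ∀ i, 0 ≤ q i ∧ q i ≤ 1) (lv : κ → ℕ) (a : κ → ℕ)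
    (g : κ → ℝ) (hg : ∀ k, 0 ≤ g k ∧ g k ≤ 1) (j : ℕ) (hlv : ∀ k, 0 < a k → lv k ≤ D)
    (hstrong : ∀ k, 0 < a k → (2 * j : ℝ) < (∑ k', (a k' : ℝ)) * g k) (hne : ∃ k, 0 < a k)
    (x : ℝ) (hx : ∀ k, 0 < a k → x ≤ (∏ i ∈ Finset.range (lv k), q i) * g k) :
    x ≤ TAIL[D, q, lv, a, g, j] := by
  obtain ⟨k, hk, h⟩ := tail_ge_marg_strong D q hq lv a g hg j hlv hstrong hne
  exact (hx k hk).trans h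

end BlockComb

end Quant

end Summit.CriticalPhenomena.PercolationContinuityZ3.Theorems
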